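import Summits.Langlands.Langlands.Theorems.PicardMuOrdinaryMuOrdinaryFamilyRTThorneCompanionsDebts
import Literature.NumberTheory.GaloisRepresentations.FramedRepTwistTraceLocalProofs
import HarnessLib

/-!
# Crux `MuOrdinaryFamilyRT` (stmt-Langlands-13757), line `thorne-minimal-lift`: glue G5 of
# `stub_pointAutomorphicT` — the trace polarization of a twist (`tracePolarized_twist`, PROVED)

`TracePolarized F' m r` (…ThorneCompanionsDebts § 1) records the polarization of a framed
`r : Γ_{F'} → GL₃(ℚ̄₃)` in trace form, `tr r(θ_c σ) = ε(σ)^m · tr r(σ⁻¹)`, along the outer action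
`θ_c = absGaloisOuterConj ℚ F' c` of every complex conjugation `c ∈ Γ_ℚ` (`F'/ℚ` Galois).  Twisting
`r` by a continuous character `θ : Γ_{F'} → ℚ̄₃ˣ` with `θ(θ_c σ) · θ(σ) = ε(σ)^k` (a character
"polarized of weight `k`", e.g. an algebraic Hecke character of the CM field `F'` of parallel weight)
gives a representation `r ⊗ θ` (`FramedRep.twist`) polarized in trace form with exponent `m + k`:

  `tr (r ⊗ θ)(θ_c σ) = θ(θ_c σ) · ε(σ)^m · tr r(σ⁻¹)`                  (`FramedRep.trace_twist`, hyp.)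
  `ε(σ)^{m+k} · tr (r ⊗ θ)(σ⁻¹) = ε(σ)^m · (θ(θ_c σ) θ(σ)) · θ(σ)⁻¹ · tr r(σ⁻¹)`,

and `θ(σ) θ(σ)⁻¹ = 1` in `ℚ̄₃ˣ`.  Pure algebra; this is the registered stub `tracePolarized_twist`
(glue G5 of the blueprint `thorne-minimal-lift-pointAutomorphic.md`), used to move the polarization
exponent of an arithmetic point to the one Thorne's theorem
(`Thorne2017.automorphyLifting_unitary_ordinaryMinimal`) consumes.
-/

set_option linter.dupNamespace false -- `Summit.Langlands.Langlands.…` is the problem's namespace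

namespace Summit.Langlands.Langlands.Cruxes.MuOrdinaryFamilyRT.ThorneMinimalLift

open scoped NumberField Polynomial Matrix Classical
open Field IsDedekindDomain Polynomial
open Literature.NumberTheory.GaloisRepresentations Literature.NumberTheory.Automorphic
open Summit.Langlands.Langlands.Cruxes.MuOrdinaryFamilyRT.CharZeroDominance

noncomputable section

/-- **Trace polarization of a twist (glue G5 of `stub_pointAutomorphicT`).**  If `ρ : Γ_{F'} → GL₃(ℚ̄₃)`
is polarized in trace form with exponent `m` (`TracePolarized F' m ρ`:
`tr ρ(θ_c σ) = ε(σ)^m · tr ρ(σ⁻¹)` for every complex conjugation `c ∈ Γ_ℚ`) and the continuous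
character `θ : Γ_{F'} → ℚ̄₃ˣ` satisfies `θ(θ_c σ) · θ(σ) = ε(σ)^k` for the same `c`, `σ`, then the
twist `ρ ⊗ θ` is polarized in trace form with exponent `m + k`.  Proof: `tr (ρ ⊗ θ) = θ · tr ρ`
(`FramedRep.trace_twist`), `ε(σ)^{m+k} = ε(σ)^m ε(σ)^k` (`zpow_add`), `θ(σ⁻¹) = θ(σ)⁻¹`, and
`θ(σ) θ(σ)⁻¹ = 1`. -/
theorem tracePolarized_twist : ∀ (F' : Type) [Field F'] [NumberField F'] [IsGalois ℚ F'] (m k : ℤ) (ρ : FramedGaloisRep F' (PadicAlgCl 3) 3) (θ : absoluteGaloisGroup F' →ₜ* (PadicAlgCl 3)ˣ), TracePolarized F' m ρ → (∀ c : absoluteGaloisGroup ℚ, IsComplexConjugation (algebraMap ℚ ℝ) c → ∀ σ : absoluteGaloisGroup F', ((θ (absGaloisOuterConj ℚ F' c σ) : (PadicAlgCl 3)ˣ) : PadicAlgCl 3) * (θ σ : PadicAlgCl 3) = algebraMap ℤ_[3] (PadicAlgCl 3) (((GaloisRep.cyclotomicCharacter F' 3 σ) ^ k : ℤ_[3]ˣ)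 : ℤ_[3])) → TracePolarized F' (m + k) (ρ.twist θ) := by
  intro F' _ _ _ m k ρ θ hρ hθ c hc σ
  rw [FramedRep.trace_twist, FramedRep.trace_twist, hρ c hc σ, zpow_add, Units.val_mul, map_mul,
    ← hθ c hc σ, map_inv, mul_assoc (algebraMap ℤ_[3] (PadicAlgCl 3) _),
    mul_assoc ((θ (absGaloisOuterConj ℚ F' c σ) : (PadicAlgCl 3)ˣ) : PadicAlgCl 3),
    Units.mul_inv_cancel_left]
  exact mul_left_comm _ _ _

end

end Summit.Langlands.Langlands.Cruxes.MuOrdinaryFamilyRT.ThorneMinimalLift
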